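import Literature.AlgebraicTopology.SingularHomology.LerayHirschGlobal
import Literature.AlgebraicTopology.SingularHomology.ProductWithContractible
import Literature.AlgebraicTopology.SingularHomology.SphereLikeCupForm
import Literature.AlgebraicTopology.SingularHomology.CohomologyMayerVietorisExtend
import Mathlib.Topology.EMetricSpace.Paracompact
import HarnessLib

/-!
# The Künneth theorem for `M × N`, `M` a manifold: `H*(M × N; R)` is free over `H*(M; R)` on a graded basis of `H*(N; R)`

A. Hatcher, *Algebraic Topology* (2002), §3.2 Thm. 3.16 ("`H*(X × Y; R) → H*(X; R) ⊗ H*(Y; R)`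
is an isomorphism if `Hᵏ(Y; R)` is a finitely generated free `R`-module for all `k`") in the
form of the Leray–Hirsch theorem 4D.1 for the product bundle `pr₁ : M × N → M` (Husemoller,
*Fibre Bundles*, Ch. 17 §1 Thm. 1.1: "for `E = B × F` the theorem is a direct consequence of the
Künneth formula" — here, conversely, Künneth is OBTAINED from the tree's proved Leray–Hirsch
engine). Statement (`LerayHirsch.bijective_lhMap_fst_prod`): let `e j ∈ H^{d j}(N; R)`
(`j : ι`, finite) be a GRADED BASIS of `H*(N; R)` in the sense that over the one-point base the
comparison map `(aⱼ) ↦ Σⱼ aⱼ ⌣ eⱼ : Π_{d j ≤ k} Hᵏ⁻ᵈʲ(pt) → Hᵏ(N)` is bijective for every `k`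
(`isGradedBasis_of_basis`: e.g. the union of bases of the `Hᵏ(N; R)`, `k ≤ D`, when
`Hᵏ(N; R) = 0` for `k > D`); let `M` be a paracompact Hausdorff space with an atlas modelled on a
second-countable real normed space. Then

  `θ : Π_{d j ≤ k} Hᵏ⁻ᵈʲ(M; R) → Hᵏ(M × N; R)`, `(aⱼ) ↦ Σⱼ pr₁^* aⱼ ⌣ pr₂^* eⱼ`,

is bijective for every `k`; in particular (`mem_span_cupProduct_fst_snd`) every class on `M × N`
is an `R`-linear combination of cross products `pr₁^* a ⌣ pr₂^* b`.

Proof (Hatcher's bootstrap for Thm. 3.16 / Poincaré duality, §3.3 pp. 245–247, run inside the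
Leray–Hirsch engine `LerayHirschGlobal.bijective_of_cover`): over a contractible base piece `U`,
`U × N ≃ N` and `θ` IS the graded-basis condition (`bijective_lhMap_fst_of_contractible`,
transport `bijective_lhMap_iff` along a fibre inclusion); convex open subsets of the model space
are contractible, finite unions of convex open sets are reached by the union step `isLH_union`
(the intersections `C ∩ Cᵢ` are again convex), arbitrary open subsets by an increasing exhaustion
by finite unions of balls (`bijective_of_exhaustion`), and the manifold by its charts
(`bijective_of_cover`). Everything is proved; no named facts. Universe: spaces and coefficients in
`Type` (as in the tree's `CharacteristicClasses` consumers of the engine; the intended model spaces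
`EuclideanSpace ℝ (Fin m)` and the complex points `X(ℂ)` of the Hodge-theory files live there).

## References

* [HatcherAT2002] A. Hatcher, *Algebraic Topology*, CUP 2002, §3.2 Thm. 3.16, §4.D Thm. 4D.1,
  §3.3 pp. 245–247 (the bootstrap over open subsets of `ℝⁿ`).
* [HusemollerFibreBundles1994] D. Husemoller, *Fibre Bundles*, 3rd ed. (1994), Ch. 17 §1 Thm. 1.1.
-/

noncomputable section

open CategoryTheory Function Set

namespace Literature.AlgebraicTopology.SingularHomology

namespace LerayHirsch

variable (R : Type) [CommRing R] {ι : Type} [Fintype ι] (d : ι → ℕ)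
variable {N : Type} [TopologicalSpace N] (e : (j : ι) → singularCohomology R R N (d j))

/-! ### The base case: a contractible base -/

/-- **Künneth over a contractible base.** If over the one-point base the comparison map
`(aⱼ) ↦ Σⱼ aⱼ ⌣ eⱼ` of the classes `eⱼ ∈ H^{d j}(N; R)` is bijective in every degree, then so is
`θ : Π_{d j ≤ k} Hᵏ⁻ᵈʲ(U) → Hᵏ(U × N)`, `(aⱼ) ↦ Σⱼ pr₁^* aⱼ ⌣ pr₂^* eⱼ`, for every contractible `U`:
transport along the fibre inclusion `N → U × N` over `pt → U`, both cohomology isomorphisms.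
[cite: HatcherAT2002, §3.2 Thm. 3.16 (proof, the case of a point)] -/
theorem bijective_lhMap_fst_of_contractible
    (he : ∀ k, Bijective (lhMap R d (ContinuousMap.const N PUnit.unit : C(N, PUnit.{1})) e k))
    (U : Type) [TopologicalSpace U] [ContractibleSpace U] (k : ℕ) :
    Bijective (lhMap R d (ContinuousMap.fst : C(U × N, U))
      (fun j ↦ singularCohomology.map R R (ContinuousMap.snd : C(U × N, N)) (d j) (e j)) k) := by
  obtain ⟨E⟩ := ContractibleSpace.hequiv U PUnit.{1}
  let g : C(PUnit.{1}, U) := E.invFun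
  let u₀ : U := g PUnit.unit
  have hfg : (ContinuousMap.fst : C(U × N, U)).comp (fibreIncl u₀) =
      g.comp (ContinuousMap.const N PUnit.unit : C(N, PUnit.{1})) := by
    ext n; rfl
  have hf : ∀ n, Bijective (singularCohomology.map R R (fibreIncl (Y := N) u₀) n) := by
    intro n
    have hfac : fibreIncl (Y := N) u₀ = (Homeomorph.prodComm N U : C(N × U, U × N)).comp (sliceAt u₀) := by
      ext x <;> rfl
    rw [hfac, singularCohomology.map_comp]
    exact (map_sliceAt_bijective R R (U := N) u₀ n).comp
      (singularCohomology.mapIso R R (Homeomorph.prodComm N U) n).toLinearEquiv.bijective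
  have hg : ∀ n, Bijective (singularCohomology.map R R g n) := fun n ↦
    (singularCohomology.isoOfHomotopyEquiv' R R E n).symm.toLinearEquiv.bijective
  rw [bijective_lhMap_iff R d _ _ (fibreIncl u₀) g hfg _ hf hg k]
  have hcls : (fun j ↦ singularCohomology.map R R (fibreIncl (Y := N) u₀) (d j)
      (singularCohomology.map R R (ContinuousMap.snd : C(U × N, N)) (d j) (e j))) = e := by
    funext j
    rw [← ModuleCat.comp_apply, ← singularCohomology.map_comp]
    change singularCohomology.map R R (ContinuousMap.id N) (d j) (e j) = e j
    rw [singularCohomology.map_id]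
    rfl
  rw [hcls]
  exact he k

/-! ### Pieces `W × N ⊆ B × N` over subsets `W ⊆ B` of the base -/

section Pieces

variable {B : Type} [TopologicalSpace B]

/-- **`IsLH W` for the product projection is the bijectivity of `θ` for `pr₁ : W × N → W`** with
the classes `pr₂^* eⱼ` (along `(pr₁ : B × N → B)⁻¹ W = W ×ˢ univ ≃ₜ W × N`). [folklore] -/
theorem isLH_fst_iff (W : Set B) :
    IsLH R d (ContinuousMap.fst : C(B × N, B))
        (fun j ↦ singularCohomology.map R R (ContinuousMap.snd : C(B × N, N)) (d j) (e j)) W ↔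
      ∀ k, Bijective (lhMap R d (ContinuousMap.fst : C(↥W × N, ↥W))
        (fun j ↦ singularCohomology.map R R (ContinuousMap.snd : C(↥W × N, N)) (d j) (e j)) k) := by
  let φ : ↥((ContinuousMap.fst : C(B × N, B)) ⁻¹' W) ≃ₜ ↥W × N :=
    ((Homeomorph.setCongr (Set.prod_univ (s := W) (β := N)).symm).trans (Homeomorph.Set.prod W univ)).trans
      ((Homeomorph.refl ↥W).prodCongr (Homeomorph.Set.univ N))
  refine bijective_iff_of_homeomorph R d (resMap (ContinuousMap.fst : C(B × N, B)) W)
    (ContinuousMap.fst : C(↥W × N, ↥W)) φ.symm (Homeomorph.refl ↥W) ?_ _ _ fun j ↦ ?_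
  · ext x; rfl
  · rw [← ModuleCat.comp_apply, ← singularCohomology.map_comp, ← ModuleCat.comp_apply,
      ← singularCohomology.map_comp]
    rfl

end Pieces

/-! ### Open subsets of the model space -/

section Model

variable {E : Type} [NormedAddCommGroup E] [NormedSpace ℝ E]
variable (he : ∀ k, Bijective (lhMap R d (ContinuousMap.const N PUnit.unit : C(N, PUnit.{1})) e k))
include he

/-- **`IsLH C` over a convex subset `C` of the model space** (empty, or contractible).
[cite: HatcherAT2002, §3.3 p. 246 (step (1) of the bootstrap)] -/
theorem isLH_fst_of_convex {C : Set E} (hC : Convex ℝ C) :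
    IsLH R d (ContinuousMap.fst : C(E × N, E))
      (fun j ↦ singularCohomology.map R R (ContinuousMap.snd : C(E × N, N)) (d j) (e j)) C := by
  rcases C.eq_empty_or_nonempty with rfl | hne
  · exact isLH_empty R d _ _
  · haveI := hC.contractibleSpace hne
    exact (isLH_fst_iff R d e C).2 (bijective_lhMap_fst_of_contractible R d e he ↥C)

/-- **`IsLH` over a finite union of convex open subsets of the model space**: induction on the
number of sets with the union step `isLH_union`, the intersection of `C` with a union of convex
open sets being the union of the convex open sets `C ∩ Cᵢ`.
[cite: HatcherAT2002, §3.3 p. 246 (steps (2)–(3) of the bootstrap)] -/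
theorem isLH_fst_biUnion_convex {α : Type*} (s : Finset α) :
    ∀ (C : α → Set E), (∀ i ∈ s, IsOpen (C i)) → (∀ i ∈ s, Convex ℝ (C i)) →
      IsLH R d (ContinuousMap.fst : C(E × N, E))
        (fun j ↦ singularCohomology.map R R (ContinuousMap.snd : C(E × N, N)) (d j) (e j)) (⋃ i ∈ s, C i) := by
  classical
  induction s using Finset.induction_on with
  | empty =>
    intro C _ _
    rw [show (⋃ i ∈ (∅ : Finset α), C i) = ∅ by simp]
    exact isLH_empty R d _ _
  | insert a s ha ih =>
    intro C hCo hCc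
    rw [Finset.set_biUnion_insert]
    have hso : IsOpen (⋃ i ∈ s, C i) := isOpen_biUnion fun i hi ↦ hCo i (Finset.mem_insert_of_mem hi)
    refine isLH_union R d _ _ (hCo a (Finset.mem_insert_self a s)) hso
      (isLH_fst_of_convex R d e he (hCc a (Finset.mem_insert_self a s)))
      (ih C (fun i hi ↦ hCo i (Finset.mem_insert_of_mem hi)) fun i hi ↦ hCc i (Finset.mem_insert_of_mem hi)) ?_
    rw [inter_iUnion₂]
    exact ih (fun i ↦ C a ∩ C i)
      (fun i hi ↦ (hCo a (Finset.mem_insert_self a s)).inter (hCo i (Finset.mem_insert_of_mem hi)))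
      fun i hi ↦ (hCc a (Finset.mem_insert_self a s)).inter (hCc i (Finset.mem_insert_of_mem hi))

/-- **`IsLH` over every open subset of a second-countable model space**: an open set is an
increasing union of finite unions of open balls contained in it (Lindelöf), and `θ` passes to
increasing open unions (`bijective_of_exhaustion`, Milnor's telescope).
[cite: HatcherAT2002, §3.3 pp. 246–247 (step (4) of the bootstrap)] -/
theorem isLH_fst_of_isOpen [SecondCountableTopology E] {W : Set E} (hW : IsOpen W) :
    IsLH R d (ContinuousMap.fst : C(E × N, E))
      (fun j ↦ singularCohomology.map R R (ContinuousMap.snd : C(E × N, N)) (d j) (e j)) W := by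
  rcases W.eq_empty_or_nonempty with rfl | hne
  · exact isLH_empty R d _ _
  -- balls inside `W` around its points, a countable subfamily with the same union, enumerated
  have hball : ∀ x : ↥W, ∃ r > 0, Metric.ball (x : E) r ⊆ W := fun x ↦ Metric.isOpen_iff.1 hW x x.2
  choose r hr hrW using hball
  obtain ⟨T, hTc, hTU⟩ := TopologicalSpace.isOpen_iUnion_countable (fun x : ↥W ↦ Metric.ball (x : E) (r x))
    fun x ↦ Metric.isOpen_ball
  have hUW : (⋃ x : ↥W, Metric.ball (x : E) (r x)) = W :=
    Subset.antisymm (iUnion_subset fun x ↦ hrW x) fun y hy ↦ mem_iUnion.2 ⟨⟨y, hy⟩, Metric.mem_ball_self (hr _)⟩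
  have hTne : T.Nonempty := by
    by_contra hT
    rw [not_nonempty_iff_eq_empty] at hT
    rw [hT, hUW] at hTU
    simp only [mem_empty_iff_false, iUnion_of_empty, iUnion_empty] at hTU
    exact hne.ne_empty hTU.symm
  obtain ⟨t, ht⟩ := hTc.exists_eq_range hTne
  -- the exhaustion `V n = B(t 0) ∪ ⋯ ∪ B(t n)`
  let V : ℕ → Set E := fun n ↦ ⋃ i ∈ Finset.range (n + 1), Metric.ball (t i : E) (r (t i))
  have hVo : ∀ n, IsOpen (V n) := fun n ↦ isOpen_biUnion fun i _ ↦ Metric.isOpen_ball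
  have hVmono : Monotone V := by
    refine monotone_nat_of_le_succ fun n ↦ ?_
    exact biUnion_subset_biUnion_left fun i hi ↦ Finset.mem_range.2 ((Finset.mem_range.1 hi).trans (Nat.lt_succ_self _))
  have hVW : ∀ n, V n ⊆ W := fun n ↦ iUnion₂_subset fun i _ ↦ hrW (t i)
  have hVcov : (⋃ n, V n) = W := by
    refine Subset.antisymm (iUnion_subset hVW) fun y hy ↦ ?_
    rw [← hUW, ← hTU, ht] at hy
    obtain ⟨x, hx, hyx⟩ := mem_iUnion₂.1 hy
    obtain ⟨i, rfl⟩ := hx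
    exact mem_iUnion.2 ⟨i, mem_iUnion₂.2 ⟨i, Finset.mem_range.2 (Nat.lt_succ_self i), hyx⟩⟩
  have hV : ∀ n, IsLH R d (ContinuousMap.fst : C(E × N, E))
      (fun j ↦ singularCohomology.map R R (ContinuousMap.snd : C(E × N, N)) (d j) (e j)) (V n) := fun n ↦
    isLH_fst_biUnion_convex R d e he (Finset.range (n + 1)) (fun i ↦ Metric.ball (t i : E) (r (t i)))
      (fun i _ ↦ Metric.isOpen_ball) fun i _ ↦ convex_ball _ _
  -- pass to the increasing union inside the base `↥W`
  intro k
  refine bijective_of_exhaustion R d (resMap (ContinuousMap.fst : C(E × N, E)) W) (resCls (ContinuousMap.fst : C(E × N, E)) W _)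
    (V := fun n ↦ Subtype.val ⁻¹' V n) (fun n ↦ (hVo n).preimage continuous_subtype_val)
    (fun m n hmn ↦ preimage_mono (hVmono hmn)) ?_ (fun n ↦ (isLH_iff_piece R d _ _ (hVW n)).1 (hV n)) k
  refine eq_univ_of_forall fun x ↦ ?_
  have hx : (x : E) ∈ ⋃ n, V n := by rw [hVcov]; exact x.2
  obtain ⟨n, hn⟩ := mem_iUnion.1 hx
  exact mem_iUnion.2 ⟨n, hn⟩

end Model

/-! ### The theorem: a manifold base -/

section Manifold

variable (E : Type) [NormedAddCommGroup E] [NormedSpace ℝ E] [SecondCountableTopology E]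
variable {M : Type} [TopologicalSpace M] [ChartedSpace E M]

/-- **`IsLH W` for `pr₁ : M × N → M` over an open subset `W` of a chart source**: transport of
`isLH_fst_of_isOpen` along the chart. [cite: HusemollerFibreBundles1994, Ch. 17 §1 Thm. 1.1 (proof, the trivialising open sets)] -/
theorem isLH_fst_of_subset_chart_source
    (he : ∀ k, Bijective (lhMap R d (ContinuousMap.const N PUnit.unit : C(N, PUnit.{1})) e k))
    (x : M) {W : Set M} (hWo : IsOpen W) (hW : W ⊆ (chartAt E x).source) :
    IsLH R d (ContinuousMap.fst : C(M × N, M))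
      (fun j ↦ singularCohomology.map R R (ContinuousMap.snd : C(M × N, N)) (d j) (e j)) W := by
  let φ := chartAt E x
  have hW'o : IsOpen (φ '' W) := φ.isOpen_image_of_subset_source hWo hW
  let h : ↥W ≃ₜ ↥(φ '' W) := φ.homeomorphOfImageSubsetSource hW rfl
  have h₁ := (isLH_fst_iff R d e (φ '' W)).1 (isLH_fst_of_isOpen R d e he hW'o)
  refine (isLH_fst_iff R d e W).2 ((bijective_iff_of_homeomorph R d (ContinuousMap.fst : C(↥(φ '' W) × N, ↥(φ '' W)))
    (ContinuousMap.fst : C(↥W × N, ↥W)) (h.prodCongr (Homeomorph.refl N)) h ?_ _ _ fun j ↦ ?_).1 h₁)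
  · ext p
    rfl
  · rw [← ModuleCat.comp_apply, ← singularCohomology.map_comp]
    rfl

include E in
/-- **The Künneth theorem for `M × N` over a manifold `M`** (Hatcher Thm. 3.16 via Leray–Hirsch
Thm. 4D.1 for the product bundle): if the classes `eⱼ ∈ H^{d j}(N; R)` form a graded basis of
`H*(N; R)` — over the one-point base, `(aⱼ) ↦ Σⱼ aⱼ ⌣ eⱼ : Π_{d j ≤ k} Hᵏ⁻ᵈʲ(pt) → Hᵏ(N)` is
bijective for every `k` — and `M` is a paracompact Hausdorff space with an atlas modelled on a
second-countable real normed space, then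
`θ : Π_{d j ≤ k} Hᵏ⁻ᵈʲ(M; R) → Hᵏ(M × N; R)`, `(aⱼ) ↦ Σⱼ pr₁^* aⱼ ⌣ pr₂^* eⱼ`, is bijective for
every `k`: `H*(M × N; R)` is a free `H*(M; R)`-module on the `pr₂^* eⱼ`.
[cite: HatcherAT2002, §3.2 Thm. 3.16 and §4.D Thm. 4D.1] [cite: HusemollerFibreBundles1994, Ch. 17 §1 Thm. 1.1] -/
theorem bijective_lhMap_fst_prod [T2Space M] [ParacompactSpace M]
    (he : ∀ k, Bijective (lhMap R d (ContinuousMap.const N PUnit.unit : C(N, PUnit.{1})) e k)) (k : ℕ) :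
    Bijective (lhMap R d (ContinuousMap.fst : C(M × N, M))
      (fun j ↦ singularCohomology.map R R (ContinuousMap.snd : C(M × N, N)) (d j) (e j)) k) :=
  bijective_of_cover R d _ _ (fun x : M ↦ (chartAt E x).source) (fun x ↦ (chartAt E x).open_source)
    (eq_univ_of_forall fun x ↦ mem_iUnion.2 ⟨x, mem_chart_source E x⟩)
    (fun x _ hWo hW ↦ isLH_fst_of_subset_chart_source R d e E he x hWo hW) k

include E in
/-- **Künneth, spanning form**: under the same hypotheses every class on `M × N` is an `R`-linear
combination of cross products `pr₁^* a ⌣ pr₂^* b`. [cite: HatcherAT2002, §3.2 Thm. 3.16] -/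
theorem mem_span_cupProduct_fst_snd [T2Space M] [ParacompactSpace M]
    (he : ∀ k, Bijective (lhMap R d (ContinuousMap.const N PUnit.unit : C(N, PUnit.{1})) e k)) (k : ℕ)
    (z : singularCohomology R R (M × N) k) :
    z ∈ Submodule.span R {v | ∃ (i j : ℕ) (h : i + j = k) (a : singularCohomology R R M i) (b : singularCohomology R R N j),
      v = cupProduct h (singularCohomology.map R R (ContinuousMap.fst : C(M × N, M)) i a)
        (singularCohomology.map R R (ContinuousMap.snd : C(M × N, N)) j b)} := by
  obtain ⟨a, rfl⟩ := (bijective_lhMap_fst_prod R d e E he (M := M) k).2 z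
  rw [lhMap_apply]
  refine Submodule.sum_mem _ fun j _ ↦ ?_
  split_ifs with h
  · exact Submodule.subset_span ⟨k - d j, d j, Nat.sub_add_cancel h, a ⟨j, h⟩, e j, rfl⟩
  · exact Submodule.zero_mem _

end Manifold

end LerayHirsch

end Literature.AlgebraicTopology.SingularHomology
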